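import Summits.BirchSwinnertonDyer.BirchSwinnertonDyer.Theses.PrintX10b
import Summits.BirchSwinnertonDyer.BirchSwinnertonDyer.Theorems.PrintX10bHowardContainmentAnyClassNumberX10bThm413Hyp
import Summits.BirchSwinnertonDyer.BirchSwinnertonDyer.Theorems.PrintX10bHowardContainmentLightFrameX10bEnvelope
import Literature.NumberTheory.EllipticCurves.CastellaGrossiSkinner2025.HeegnerKolyvaginBoundAnyClassNumberProofs
import Literature.NumberTheory.EllipticCurves.HeegnerCharIdealEnvelopeProofs
import Literature.NumberTheory.EllipticCurves.HeegnerCharIdealEnvelopePowTransferProofs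
import Literature.NumberTheory.EllipticCurves.IwasawaAlgebraPromotionProofs
import Literature.NumberTheory.EllipticCurves.IwasawaAlgebraMuPromotionProofs
import HarnessLib

/-!
# The deciding crux `PrintX10b.HowardContainmentLightFrameX10bPinnedOfPrint` (stmt-BirchSwinnertonDyer-27275, row 10,
# PrintX10b rev 35) MODULO ONE RESIDUAL STATEMENT IN THE STABILISED CURRENCY — the μ-INEQUALITY
# `μ(𝒳_tors) ≤ 2·μ(𝔖/Λκ_∞(C))` at `3 ∣ h_K` — CONDITIONAL CLOSER (line `torsion-depth-x10b-pinned`, rev-35 reshape)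

Cell `pub/bsd-print-x9`, LEAD `bsd-line-x10b-p2` (g3). THEOREMS + two statement abbreviations; no named fact, no `sorry`;
`--supports stmt-BirchSwinnertonDyer-27275`; the crux is NOT closed here; no summit statement is proved by this seat; BSD is
not proved by any of this.

WHY THIS SHAPE (x9-p1-w2 g3 FINDING 10:02:01Z, concurred): the rev-27 skeleton's residual `stub_muPartSharp` was the μ-part as
an F-currency package quantified over EVERY Heegner family `F` on `Dt`. A port of the μ-argument (MZ26 Thm 3.15 (iii) re-based
at `p ∣ h_K` per CGLS22 §4.1; Howard 2004 Thm 2.2.10, specialisation at `q_m = T^m + p`) proves the μ-inequality for the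
Λ-adic CLASS, i.e. for CGLS's stabilised module `Λκ_∞(C)` — no family, no `Dt`. The crux's composition only ever needs the
engine's coherent pair `(C, F)` with the SHARP inclusion `ℋ_F ≤ Λκ_∞(C)` (`X10.envelopeModulesSharp_of_towerSharp`,
p621830), so the residual is re-cut to exactly that: `Stmt.muInequalityStabilized` below (lengthAt currency; the
`muInvariant` twin `Stmt.muInequalityStabilizedInvariant` is offered too). The closer
`howardContainmentLightFrameX10bPinnedOfPrint_of_muStabilized : Stmt.muInequalityStabilized →
HowardContainmentLightFrameX10bPinnedOfPrint` is the crux BY NAME from its one residual: `3 ∤ h_K` by MZ26 Cor. 4.6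
(`X10.heegnerContainmentPinned_of_cor46_of_not_surj`, p607508); `3 ∣ h_K`: thm411 (binder `hNV`) ⇒ `𝔖/Λκ_C` torsion,
thm652 (binder `hCGS`) ⇒ `(3^m)·I(Λκ_C)² ⊆ char(𝒳_tors)`, the μ-inequality + x10b-p1's promotion (p613811 / p614273) ⇒
`I(Λκ_C)² ⊆ char(𝒳_tors)`, `ℋ_F ≤ Λκ_C` ⇒ `I(ℋ_F) ≤ I(Λκ_C)` (`heegnerCharIdeal_le_stabilizedHeegnerCharIdeal_of_le`)
⇒ `I(ℋ_F)² ⊆ char(𝒳_tors)` with `F.Dt = Dt`. RECOMMENDED split text for the row-10 μ-item = `Stmt.muInequalityStabilized`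
verbatim; glue = the closer. The μ-inequality is BEYOND citable PRINT at `3 ∣ h_K` (REF-118). «beyond-print theorem»: no.

References: Mastella–Zerman, arXiv:2505.08710, Thm. 3.15, Cor. 4.6; Castella–Grossi–Lee–Skinner, Invent. Math. 227 (2022),
Thm. 4.1.1, Rem. 4.1.4; Castella–Grossi–Skinner, Math. Ann. 393 (2025), Thm. 6.5.2; Howard, Compositio 140 (2004), Thm.
2.2.10, §3.3; Washington, GTM 83, §13.2.
-/

set_option linter.dupNamespace false
set_option autoImplicit false

noncomputable section

open scoped Classical Pointwise
open Literature Literature.NumberTheory.EllipticCurves WeierstrassCurve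
  Literature.NumberTheory.EllipticCurves.ModularForms
  Literature.NumberTheory.EllipticCurves.CastellaGrossiLeeSkinner2022
open Literature.NumberTheory.EllipticCurves.Rank1Residual (ClassX10 Surj)
open Summit.BirchSwinnertonDyer.BirchSwinnertonDyer.Theses.PrintX10b
  (MastellaZermanHowardDivisibility CGLSHeegnerClassNonvanishing
    CGSHowardDivisibilityPLocalized AnticyclotomicTowerSharp HowardContainmentLightFrameX10bPinned
    HowardContainmentLightFrameX10bPinnedOfPrint)

namespace Summit.BirchSwinnertonDyer.BirchSwinnertonDyer.Theorems.PrintX10bSharpMuStabilized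

/-! ## §1 The residual statement, two currencies (the registered stub letter is the `lengthAt` one) -/

/-- **RESIDUAL STATEMENT `Stmt.muInequalityStabilized`** (= the registered stub letter of the rev-35 skeleton on
stmt-BirchSwinnertonDyer-27275, namespace `…Cruxes.HowardContainmentLightFrameX10bPinnedOfPrint.TorsionDepthX10bPinned`,
VERBATIM, re-homed here): on every rank-one light X10b Heegner frame with `p ∣ h_K`, for every `jbar`, every Λ-adic Selmer
datum `D`, every CGLS stabilised datum `C` and every Selmer dual datum `X` with `𝔖`, `𝒳` finitely generated and `𝔖/Λκ_∞(C)`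
torsion: `length_(p)(𝒳_{Λ-tors}) ≤ 2·length_(p)(𝔖/Λκ_∞(C))`. A statement abbreviation; NOT asserted, NOT a named fact; no
witness in the tree (this is the crux's residual, beyond citable print at `3 ∣ h_K`). -/
abbrev Stmt.muInequalityStabilized : Prop :=
    ∀ (W : WeierstrassCurve ℚ) [W.IsElliptic] [W.IsGloballyMinimal] (p : ℕ) [Fact p.Prime]
      [NeZero (W.conductorNorm ℤ)] (K : Type) [Field K] [NumberField K],
      ClassX10 W p → ¬ Surj W 3 → ¬ W.HasCM →
      IsImaginaryQuadratic K → Odd (NumberField.discr K) → NumberField.discr K ≠ -3 →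
      SatisfiesHeegnerHypothesis (W.conductorNorm ℤ) K → SatisfiesHeegnerHypothesis p K →
      (W.baseChange K).HasIrreducibleModPGaloisRep p →
      ∀ (κ : ZpExtension K p), κ.IsAnticyclotomic → ∀ (γ : Field.absoluteGaloisGroup K),
      κ.IsTopGenerator γ →
      (W.baseChange K).mordellWeilRank = 1 →
      Finite (AddCommGroup.primaryComponent (W.baseChange K).sha p) →
      p ∣ NumberField.classNumber K →
      ∀ (jbar : AlgebraicClosure K →+* ℂ) (D : (W.baseChange K).LambdaAdicSelmerData κ γ)
        (C : StabilizedHeegnerData (W.conductorNorm ℤ) W K κ jbar) (X : (W.baseChange K).SelmerDualData κ γ),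
      Module.Finite (IwasawaAlgebra p) D.S → Module.Finite (IwasawaAlgebra p) X.X →
      Module.IsTorsion (IwasawaAlgebra p) (D.S ⧸ stabilizedHeegnerModule D C) →
      ∀ 𝔭 : PrimeSpectrum (IwasawaAlgebra p), 𝔭.asIdeal = Ideal.span {(p : IwasawaAlgebra p)} →
        Module.lengthAt (IwasawaAlgebra p) (Submodule.torsion (IwasawaAlgebra p) X.X) 𝔭 ≤
          2 * Module.lengthAt (IwasawaAlgebra p) (D.S ⧸ stabilizedHeegnerModule D C) 𝔭

/-- **The same residual in the `muInvariant` currency** (`μ = toNat ∘ length_(p)` on f.g. torsion modules):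
`μ(𝒳_tors) ≤ 2·μ(𝔖/Λκ_∞(C))`. A statement abbreviation; NOT asserted. -/
abbrev Stmt.muInequalityStabilizedInvariant : Prop :=
    ∀ (W : WeierstrassCurve ℚ) [W.IsElliptic] [W.IsGloballyMinimal] (p : ℕ) [Fact p.Prime]
      [NeZero (W.conductorNorm ℤ)] (K : Type) [Field K] [NumberField K],
      ClassX10 W p → ¬ Surj W 3 → ¬ W.HasCM →
      IsImaginaryQuadratic K → Odd (NumberField.discr K) → NumberField.discr K ≠ -3 →
      SatisfiesHeegnerHypothesis (W.conductorNorm ℤ) K → SatisfiesHeegnerHypothesis p K →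
      (W.baseChange K).HasIrreducibleModPGaloisRep p →
      ∀ (κ : ZpExtension K p), κ.IsAnticyclotomic → ∀ (γ : Field.absoluteGaloisGroup K),
      κ.IsTopGenerator γ →
      (W.baseChange K).mordellWeilRank = 1 →
      Finite (AddCommGroup.primaryComponent (W.baseChange K).sha p) →
      p ∣ NumberField.classNumber K →
      ∀ (jbar : AlgebraicClosure K →+* ℂ) (D : (W.baseChange K).LambdaAdicSelmerData κ γ)
        (C : StabilizedHeegnerData (W.conductorNorm ℤ) W K κ jbar) (X : (W.baseChange K).SelmerDualData κ γ),
      Module.Finite (IwasawaAlgebra p) D.S → Module.Finite (IwasawaAlgebra p) X.X →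
      Module.IsTorsion (IwasawaAlgebra p) (D.S ⧸ stabilizedHeegnerModule D C) →
      muInvariant p (Submodule.torsion (IwasawaAlgebra p) X.X) ≤
        2 * muInvariant p (D.S ⧸ stabilizedHeegnerModule D C)

/-! ## §2 The core road: the crux from a PROMOTION RULE in the stabilised currency -/

/-- **The crux from a C-currency PROMOTION RULE** (the common core of the two closers): granted, on every rank-one light
X10b frame with `p ∣ h_K`, that a `p`-localized stabilised containment `(p^m)·I(Λκ_∞(C))² ⊆ char(𝒳_tors)` with
`𝔖/Λκ_∞(C)` torsion (`𝔖`, `𝒳` f.g.) promotes to `I(Λκ_∞(C))² ⊆ char(𝒳_tors)`, the crux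
`HowardContainmentLightFrameX10bPinnedOfPrint` follows: `jbar := IsAlgClosed.lift` along `ιC`; `p ∤ h_K` by MZ26 Cor. 4.6
(`X10.heegnerContainmentPinned_of_cor46_of_not_surj`); `p ∣ h_K`: data `D`, `X` exist, the engine's coherent pair
`(C, F)` on `Dt` (`X10.envelopeModulesSharp_of_towerSharp`: `ℋ_F ≤ Λκ_C`, `g•Λκ_C ≤ ℋ_F`, `g ≠ 0`), CGLS Thm. 4.1.1
(`hNV`) at `(D, C)`, CGS Thm. 6.5.2 (`hCGS`) at `(D, C, X)`, the promotion rule, and `I(ℋ_F) ≤ I(Λκ_C)`.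
[cite: CastellaGrossiLeeSkinner2022, Thm. 4.1.1, Rem. 4.1.4] [cite: CastellaGrossiSkinner2025, Thm. 6.5.2]
[cite: MastellaZerman2026, Cor. 4.6] -/
theorem howardContainmentLightFrameX10bPinnedOfPrint_of_promotion
    (hprom : ∀ (W : WeierstrassCurve ℚ) [W.IsElliptic] [W.IsGloballyMinimal] (p : ℕ) [Fact p.Prime]
      [NeZero (W.conductorNorm ℤ)] (K : Type) [Field K] [NumberField K],
      ClassX10 W p → ¬ Surj W 3 → ¬ W.HasCM →
      IsImaginaryQuadratic K → Odd (NumberField.discr K) → NumberField.discr K ≠ -3 →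
      SatisfiesHeegnerHypothesis (W.conductorNorm ℤ) K → SatisfiesHeegnerHypothesis p K →
      (W.baseChange K).HasIrreducibleModPGaloisRep p →
      ∀ (κ : ZpExtension K p), κ.IsAnticyclotomic → ∀ (γ : Field.absoluteGaloisGroup K),
      κ.IsTopGenerator γ →
      (W.baseChange K).mordellWeilRank = 1 →
      Finite (AddCommGroup.primaryComponent (W.baseChange K).sha p) →
      p ∣ NumberField.classNumber K →
      ∀ (jbar : AlgebraicClosure K →+* ℂ) (D : (W.baseChange K).LambdaAdicSelmerData κ γ)
        (C : StabilizedHeegnerData (W.conductorNorm ℤ) W K κ jbar) (X : (W.baseChange K).SelmerDualData κ γ),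
      Module.Finite (IwasawaAlgebra p) D.S → Module.Finite (IwasawaAlgebra p) X.X →
      Module.IsTorsion (IwasawaAlgebra p) (D.S ⧸ stabilizedHeegnerModule D C) →
      ∀ m : ℕ, Ideal.span {((p : IwasawaAlgebra p) ^ m)} * stabilizedHeegnerCharIdeal D C ^ 2 ≤
          Module.charIdeal (IwasawaAlgebra p) (Submodule.torsion (IwasawaAlgebra p) X.X) →
        stabilizedHeegnerCharIdeal D C ^ 2 ≤
          Module.charIdeal (IwasawaAlgebra p) (Submodule.torsion (IwasawaAlgebra p) X.X)) :
    HowardContainmentLightFrameX10bPinnedOfPrint := by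
  intro hMZ hNV hCGS hTw W _ _ p _ _ K _ _ hX hns hcm hK hodd h3 hHN hHp hirr κ hκ γ hγ Dt H ιC hc hrk hfin
  letI : Algebra K ℂ := ιC.toAlgebra
  let jbar : AlgebraicClosure K →+* ℂ :=
    (IsAlgClosed.lift (R := K) (M := ℂ) (S := AlgebraicClosure K)).toRingHom
  have hp : p.Prime := Fact.out
  by_cases hhK : p ∣ NumberField.classNumber K
  · obtain ⟨D⟩ := LambdaAdicSelmerDataExists.nonempty_lambdaAdicSelmerData (W.baseChange K) p κ hγ
    obtain ⟨X⟩ := (W.baseChange K).nonempty_selmerDualData_holds κ γ hγ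
    -- the print-free envelope: the engine's coherent pair `(C, F)` on `Dt`, SHARP forward inclusion
    obtain ⟨C, F, -, hFDt, -, -, hle, g, hg, hrev⟩ :=
      Summit.BirchSwinnertonDyer.BirchSwinnertonDyer.Rank1Residual.X10.envelopeModulesSharp_of_towerSharp
        hX hK hodd h3 hHN hHp hκ hγ Dt H jbar (fun k ↦ hTw K p (hp.odd_of_ne_two hX.ne_two) hK κ hκ jbar k) D
    have hyp := Summit.BirchSwinnertonDyer.BirchSwinnertonDyer.Rank1Residual.X10.thm413Hypotheses_of_classX10
      hX hK h3 hHN hHp hodd hκ hγ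
    -- CGLS Thm. 4.1.1 + Cornut–Vatsal BY NAME at `(D, C)`: `𝔖` torsion-free, `𝔖/Λκ_C` torsion
    have h411 : CastellaGrossiLeeSkinner2022.thm411_torsionFree_heegnerClass_ne_bot_quotient_isTorsion.{0} := hNV
    obtain ⟨hfree, -, htorC⟩ := h411 (W.conductorNorm ℤ) W K p κ γ jbar hyp D C
    haveI := hfree
    -- CGS Thm. 6.5.2 BY NAME at `(D, C, X)`: finiteness of `𝔖`, `𝒳` and the p-localized bound in C-currency
    have h652 : CastellaGrossiSkinner2025.thm652_stabilized_rankOne_charIdeal_torsion_dvd_pLocalized.{0} := hCGS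
    obtain ⟨⟨hfinS, -⟩, hfinX, -⟩ := h652 (W.conductorNorm ℤ) W K p κ γ jbar hyp D C X
    haveI := hfinS
    obtain ⟨m, hm⟩ := CastellaGrossiSkinner2025.span_pow_mul_sq_le_charIdeal_torsion_of_thm652_stabilized h652
      hyp D C X
    -- the promotion rule (the residual) in C-currency
    have hsqC := hprom W p K hX hns hcm hK hodd h3 hHN hHp hirr κ hκ γ hγ hrk hfin hhK jbar D C X hfinS hfinX htorC m hm
    -- torsion of `𝔖/ℋ_F` from the reverse inclusion, then `I(ℋ_F) ≤ I(Λκ_C)` from the sharp forward inclusion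
    have htor : Module.IsTorsion (IwasawaAlgebra p) (D.S ⧸ heegnerModule D F) :=
      isTorsion_quotient_heegnerModule_of_smul_stabilizedHeegnerModule_le D F C hg hrev htorC
    have hIF : heegnerCharIdeal D F ≤ stabilizedHeegnerCharIdeal D C :=
      heegnerCharIdeal_le_stabilizedHeegnerCharIdeal_of_le D F C htor hle
    exact ⟨jbar, D, F, X, hFDt, (Ideal.pow_right_mono hIF 2).trans hsqC⟩
  · have h46 : MastellaZerman2026.cor46_howardDivisibility_of_scalarImage.{0} := hMZ
    obtain ⟨D, F, X, hFD, -, hle⟩ :=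
      Summit.BirchSwinnertonDyer.BirchSwinnertonDyer.Rank1Residual.X10.heegnerContainmentPinned_of_cor46_of_not_surj
        h46 hX hns hcm hK h3 (hK.discr_lt_neg_four_of_odd hodd h3).ne hHN hHp hhK κ hκ γ hγ Dt H jbar
    exact ⟨jbar, D, F, X, hFD, hle⟩

/-! ## §3 The two CONDITIONAL CLOSERS -/

/-- **CLOSER (lengthAt currency): `Stmt.muInequalityStabilized → HowardContainmentLightFrameX10bPinnedOfPrint`** —
the crux BY NAME from its one residual; the promotion is x10b-p1's
`IwasawaAlgebra.sq_charIdeal_le_charIdeal_of_span_p_pow_mul_le_of_lengthAt_le_two_mul` (p613811) at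
`X := 𝒳_{Λ-tors}`, `Y := 𝔖/Λκ_∞(C)`. Whoever proves `Stmt.muInequalityStabilized` closes 27275 in one line.
[cite: Washington1997, §13.2] [cite: Howard2004HeegnerKolyvagin, Thm. 2.2.10 (the `q_m = T^m + p` device)] -/
theorem howardContainmentLightFrameX10bPinnedOfPrint_of_muStabilized (hμ : Stmt.muInequalityStabilized) :
    HowardContainmentLightFrameX10bPinnedOfPrint := by
  refine howardContainmentLightFrameX10bPinnedOfPrint_of_promotion ?_
  intro W _ _ p _ _ K _ _ hX hns hcm hK hodd h3 hHN hHp hirr κ hκ γ hγ hrk hfin hhK jbar D C X hfinS hfinX htorC m hm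
  haveI := hfinS
  haveI := hfinX
  haveI : IsNoetherian (IwasawaAlgebra p) X.X := isNoetherian_of_isNoetherianRing_of_finite _ _
  haveI : Module.Finite (IwasawaAlgebra p) (Submodule.torsion (IwasawaAlgebra p) X.X) := inferInstance
  haveI : Module.Finite (IwasawaAlgebra p) (D.S ⧸ stabilizedHeegnerModule D C) := inferInstance
  rw [stabilizedHeegnerCharIdeal_def] at hm ⊢
  exact IwasawaAlgebra.sq_charIdeal_le_charIdeal_of_span_p_pow_mul_le_of_lengthAt_le_two_mul
    (Submodule.torsion_isTorsion (R := IwasawaAlgebra p) (M := X.X)) htorC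
    (hμ W p K hX hns hcm hK hodd h3 hHN hHp hirr κ hκ γ hγ hrk hfin hhK jbar D C X hfinS hfinX htorC) hm

/-- **CLOSER (`muInvariant` currency): `Stmt.muInequalityStabilizedInvariant → HowardContainmentLightFrameX10bPinnedOfPrint`**
— the same with idea-16's promotion `IwasawaAlgebra.sq_charIdeal_le_charIdeal_of_span_p_pow_mul_le_of_muInvariant_le`
(p614273). [cite: Washington1997, §13.2] [cite: Howard2004HeegnerKolyvagin, Thm. 2.2.10] -/
theorem howardContainmentLightFrameX10bPinnedOfPrint_of_muStabilizedInvariant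
    (hμ : Stmt.muInequalityStabilizedInvariant) : HowardContainmentLightFrameX10bPinnedOfPrint := by
  refine howardContainmentLightFrameX10bPinnedOfPrint_of_promotion ?_
  intro W _ _ p _ _ K _ _ hX hns hcm hK hodd h3 hHN hHp hirr κ hκ γ hγ hrk hfin hhK jbar D C X hfinS hfinX htorC m hm
  haveI := hfinS
  haveI := hfinX
  haveI : IsNoetherian (IwasawaAlgebra p) X.X := isNoetherian_of_isNoetherianRing_of_finite _ _
  haveI : Module.Finite (IwasawaAlgebra p) (Submodule.torsion (IwasawaAlgebra p) X.X) := inferInstance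
  haveI : Module.Finite (IwasawaAlgebra p) (D.S ⧸ stabilizedHeegnerModule D C) := inferInstance
  rw [stabilizedHeegnerCharIdeal_def] at hm ⊢
  exact IwasawaAlgebra.sq_charIdeal_le_charIdeal_of_span_p_pow_mul_le_of_muInvariant_le
    (Submodule.torsion_isTorsion (R := IwasawaAlgebra p) (M := X.X)) htorC hm
    (hμ W p K hX hns hcm hK hodd h3 hHN hHp hirr κ hκ γ hγ hrk hfin hhK jbar D C X hfinS hfinX htorC)

/-- **The LIGHT A₃ containment itself from the four print binders and the residual** (the curried form consumers of
`HowardContainmentLightFrameX10bPinned` — e.g. `AssemblyLightTwinsX10b` — want).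
[cite: CastellaGrossiSkinner2025, Thm. 6.5.2] [cite: MastellaZerman2026, Cor. 4.6] -/
theorem howardContainmentLightFrameX10bPinned_of_print_of_muStabilized (hμ : Stmt.muInequalityStabilized)
    (hMZ : MastellaZermanHowardDivisibility) (hNV : CGLSHeegnerClassNonvanishing)
    (hCGS : CGSHowardDivisibilityPLocalized) (hTw : AnticyclotomicTowerSharp) :
    HowardContainmentLightFrameX10bPinned :=
  howardContainmentLightFrameX10bPinnedOfPrint_of_muStabilized hμ hMZ hNV hCGS hTw

end Summit.BirchSwinnertonDyer.BirchSwinnertonDyer.Theorems.PrintX10bSharpMuStabilized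

end
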